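import Summits.Parity.GeneralizedHardyLittlewood.Theorems.BeyondDiagonalBeatsQuarter.OffDiagHeartCoreTruncation
import Summits.Parity.GeneralizedHardyLittlewood.Theorems.BeyondDiagonalBeatsQuarter.OffDiagLevelBadPrimes
import HarnessLib

/-!
# Route `PrimeLevelFamEdge`, crux K_B (stmt-Parity-20343), line `diagonal_kernel_split` rev 4, plan Ω,
# K2 in BLOCK currency `OffDiagCoreLedgerBlock`: **for every set `G` of primes of the block `(N, 2N]`,
# `Σ_{q∈G} |offDiagCore (coreHeight ε₀) Δ′ q| ≤ (2N)^{(5/4)(Δ′−1)+2ε₀+ε}·Σ_{q∈G} mainScaleReal Δ′ q`, eventually in `N`**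

(Ω) of the line is a block statement (`Σ_{q∈goodPrimes Δ′ N} offDiagCore … ≤ U·Σ ms`). The trivial ledger K2
(`OffDiagHeartCoreTruncation.abs_offDiagCore_coreHeight_le`, per level) is quoted there for the pieces of the
finite dual core that are NOT funded by cancellation (exceptional level sets such as the primes `q ∣ h₁`,
residual cells): this file states it once in that currency —
* `sum_abs_offDiagCore_coreHeight_le_block` — for `0 < ε₀ ≤ 1`, `ε > 0` there is `N₀` such that for all
  `N ≥ N₀`, all `Δ′ ∈ (1,2]` and every `G ⊆ (Ioc N (2N)).filter Prime`:
  `Σ_{q∈G} |offDiagCore (coreHeight ε₀) Δ′ q| ≤ (2N)^{(5/4)(Δ′−1)+2ε₀+ε}·Σ_{q∈G} mainScaleReal Δ′ q`;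
* `sum_abs_offDiagCore_coreHeight_le_goodPrimes` — the same for every `G ⊆ goodPrimes Δ′ N`
  (`goodPrimes_subset_primes`), in particular for the whole block of good primes;
* `sum_offDiagCore_coreHeight_le_goodPrimes` — without absolute values (the shape of (Ω)'s left side, with the
  trivial `U(N) = (2N)^{(5/4)(Δ′−1)+2ε₀+ε}` in place of a constant `U < 4(Δ′−1)/Δ′`: what LIVE-Ω must beat).
Bookkeeping; nothing about the heart. Helper (`--supports stmt-Parity-20343`); standard axioms.
«The programme SEARCHES and TYPES; no claim about Landau–Siegel zeros, Theorems 1–2 of arXiv:2211.02515 or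
a repaired Margin232 until a kernel theorem says so.»
-/

noncomputable section

open Finset Polynomial
open scoped Real

namespace Summit.Parity.GeneralizedHardyLittlewood.Theorems.BeyondDiagonalBeatsQuarter.OffDiag

open Literature.NumberTheory.LFunctions Literature.NumberTheory.LFunctions.KMV2000

/-- **K2 in block currency.** For `0 < ε₀ ≤ 1`, `ε > 0` there is `N₀` such that for every `N ≥ N₀`, every
`Δ′ ∈ (1, 2]` and every set `G` of primes of `(N, 2N]`:
`Σ_{q∈G} |offDiagCore (coreHeight ε₀) Δ′ q| ≤ (2N)^{(5/4)(Δ′−1)+2ε₀+ε}·Σ_{q∈G} mainScaleReal Δ′ q`.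
[cite: KowalskiMichelVanderKam2000, (21)–(23) p. 12, §6 p. 19 — derivation] -/
theorem sum_abs_offDiagCore_coreHeight_le_block {ε₀ ε : ℝ} (hε₀ : 0 < ε₀) (hε₁ : ε₀ ≤ 1) (hε : 0 < ε) :
    ∃ N₀ : ℕ, ∀ N : ℕ, N₀ ≤ N → ∀ Δ' : ℝ, 1 < Δ' → Δ' ≤ 2 → ∀ G : Finset ℕ,
      G ⊆ (Finset.Ioc N (2 * N)).filter Nat.Prime →
        ∑ q ∈ G, |offDiagCore (coreHeight ε₀) Δ' q| ≤
          ((2 * N : ℕ) : ℝ) ^ (5 / 4 * (Δ' - 1) + 2 * ε₀ + ε) * ∑ q ∈ G, mainScaleReal Δ' q := by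
  obtain ⟨q₀, hq₀⟩ := abs_offDiagCore_coreHeight_le hε₀ hε₁ hε
  refine ⟨q₀, fun N hN Δ' h1 h2 G hG ↦ ?_⟩
  have ha0 : 0 ≤ 5 / 4 * (Δ' - 1) + 2 * ε₀ + ε := by nlinarith
  rw [Finset.mul_sum]
  refine Finset.sum_le_sum fun q hq ↦ ?_
  have hq' := hG hq
  rw [Finset.mem_filter, Finset.mem_Ioc] at hq'
  obtain ⟨⟨hNq, hq2N⟩, hprime⟩ := hq'
  haveI : NeZero q := ⟨hprime.ne_zero⟩
  have hle : q₀ ≤ q := le_trans hN hNq.le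
  have hms0 : 0 ≤ mainScaleReal Δ' q := mainScaleReal_nonneg _ _
  have hq2N' : (q : ℝ) ≤ ((2 * N : ℕ) : ℝ) := by exact_mod_cast hq2N
  calc |offDiagCore (coreHeight ε₀) Δ' q| ≤ (q : ℝ) ^ (5 / 4 * (Δ' - 1) + 2 * ε₀ + ε) * mainScaleReal Δ' q :=
        hq₀ q hle hprime Δ' h1 h2
    _ ≤ ((2 * N : ℕ) : ℝ) ^ (5 / 4 * (Δ' - 1) + 2 * ε₀ + ε) * mainScaleReal Δ' q :=
        mul_le_mul_of_nonneg_right (Real.rpow_le_rpow (Nat.cast_nonneg _) hq2N' ha0) hms0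

/-- **K2 over good primes.** The same for every `G ⊆ goodPrimes Δ′ N` (in particular the whole block).
[cite: KowalskiMichelVanderKam2000, §2 p. 7, §6 p. 19 — derivation] -/
theorem sum_abs_offDiagCore_coreHeight_le_goodPrimes {ε₀ ε : ℝ} (hε₀ : 0 < ε₀) (hε₁ : ε₀ ≤ 1)
    (hε : 0 < ε) :
    ∃ N₀ : ℕ, ∀ N : ℕ, N₀ ≤ N → ∀ Δ' : ℝ, 1 < Δ' → Δ' ≤ 2 → ∀ G : Finset ℕ, G ⊆ goodPrimes Δ' N →
      ∑ q ∈ G, |offDiagCore (coreHeight ε₀) Δ' q| ≤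
        ((2 * N : ℕ) : ℝ) ^ (5 / 4 * (Δ' - 1) + 2 * ε₀ + ε) * ∑ q ∈ G, mainScaleReal Δ' q := by
  obtain ⟨N₀, hN₀⟩ := sum_abs_offDiagCore_coreHeight_le_block hε₀ hε₁ hε
  exact ⟨N₀, fun N hN Δ' h1 h2 G hG ↦ hN₀ N hN Δ' h1 h2 G (hG.trans (goodPrimes_subset_primes Δ' N))⟩

/-- **The trivial block bound LIVE-Ω must beat**: eventually in `N`, for all `Δ′ ∈ (1,2]`,
`Σ_{q∈goodPrimes Δ′ N} offDiagCore (coreHeight ε₀) Δ′ q ≤ (2N)^{(5/4)(Δ′−1)+2ε₀+ε}·Σ_{q∈goodPrimes Δ′ N} mainScaleReal Δ′ q`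
((Ω) asks for a CONSTANT `U < 4(Δ′−1)/Δ′` in place of `(2N)^{(5/4)(Δ′−1)+2ε₀+ε}`).
[cite: KowalskiMichelVanderKam2000, §6 p. 19 — derivation] -/
theorem sum_offDiagCore_coreHeight_le_goodPrimes {ε₀ ε : ℝ} (hε₀ : 0 < ε₀) (hε₁ : ε₀ ≤ 1) (hε : 0 < ε) :
    ∃ N₀ : ℕ, ∀ N : ℕ, N₀ ≤ N → ∀ Δ' : ℝ, 1 < Δ' → Δ' ≤ 2 →
      ∑ q ∈ goodPrimes Δ' N, offDiagCore (coreHeight ε₀) Δ' q ≤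
        ((2 * N : ℕ) : ℝ) ^ (5 / 4 * (Δ' - 1) + 2 * ε₀ + ε) * ∑ q ∈ goodPrimes Δ' N, mainScaleReal Δ' q := by
  obtain ⟨N₀, hN₀⟩ := sum_abs_offDiagCore_coreHeight_le_goodPrimes hε₀ hε₁ hε
  refine ⟨N₀, fun N hN Δ' h1 h2 ↦ ?_⟩
  exact (Finset.sum_le_sum fun q _ ↦ le_abs_self _).trans (hN₀ N hN Δ' h1 h2 _ subset_rfl)

end Summit.Parity.GeneralizedHardyLittlewood.Theorems.BeyondDiagonalBeatsQuarter.OffDiag
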